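import Mathlib

/-!
# Route `SymPencil` — inner rank of the `2 | 2` row split of `per_4`: the two mixed side
# patterns of the cone dichotomies pin the subspace down to an explicit `3`-plane
# (`--supports` stmt-ValiantsHypothesis-5674 `SdcSuperquadratic`; (8,8) column, isotropic-kernel route,
# memo `NOTE-p6g15-5674-IR12-reduction.md` §2/§8, bridge step (B1))

Let `W ≤ K⁴ × K⁴` have dimension `≥ 3` and let `a ∈ K⁴` have non-zero coordinates.  Write
`y = w.1 / a`, `y' = w.2 / a` (coordinatewise), `S = Σ y`, `S' = Σ y'`.  The five dichotomies of
`SymPencilPerFourInnerRankIsotropicCone.cone_dichotomies_diag` choose, for each index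
`j ∈ {0,1,2,3,Σ}`, one of the linear conditions `2 y_j = S` / `S = 0` (p-side) or `2 y'_j = S'` /
`S' = 0` (q-side).  The two MIXED patterns (in normal position) are:

* type I (`typeI_members`): p-side at `2, 3`, q-side at `0, 1, Σ`.  Then
  `W = span{(a₂e₂ + a₃e₃, 0), (a₀e₀ - a₁e₁, 0), (0, a₂e₂ - a₃e₃)}`, in particular these three
  vectors lie in `W`;
* type II (`typeII_members`): p-side at `3, Σ`, q-side at `0, 1, 2`.  Then
  `W = span{(a₀e₀ - a₁e₁, 0), (a₁e₁ - a₂e₂, 0), (0, a₀e₀ + a₁e₁ + a₂e₂ - a₃e₃)}`.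

(Explicit coefficients, then `Submodule.eq_of_le_of_finrank_le`.)  These memberships are exactly the
hypotheses of `SymPencilPerFourInnerRankMixedKill.false_of_mixedI` and (through
`SymPencilPerFourInnerRankMixedKillTwo.cols_of_typeII`) of `false_of_mixedII`, once they hold for all
`a`; other index positions and the mirrored patterns reduce to these by the coordinate
permutations and the `y₂ ↔ y₃` swap of the design.  Honest framing: elementary linear algebra in a
conditional reduction of the cells `(8,8,10)`, `(8,8,11)`; the window `27 ≤ sdc(per_4) ≤ 29`, the
crux and `VP ≠ VNP` are untouched.  No definitions, no named facts. [folklore]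
-/

noncomputable section

-- single-conjunct layout: Sub = Summit, duplicated namespace component intended
set_option linter.dupNamespace false

namespace Summit.ValiantsHypothesis.ValiantsHypothesis.Theorems.SymPencilPerFourInnerRankSlotTypes

open Module

variable {K : Type*} [Field K]

/-- **Type I memberships** (p-side at `2,3`; q-side at `0,1,Σ`). [folklore] -/
theorem typeI_members [CharZero K] (a : Fin 4 → K) (ha : ∀ i, a i ≠ 0)
    (W : Submodule K ((Fin 4 → K) × (Fin 4 → K))) (h3 : 3 ≤ finrank K W)
    (hP2 : ∀ w ∈ W, 2 * (w.1 2 / a 2) = w.1 0 / a 0 + w.1 1 / a 1 + w.1 2 / a 2 + w.1 3 / a 3)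
    (hP3 : ∀ w ∈ W, 2 * (w.1 3 / a 3) = w.1 0 / a 0 + w.1 1 / a 1 + w.1 2 / a 2 + w.1 3 / a 3)
    (hQ0 : ∀ w ∈ W, 2 * (w.2 0 / a 0) = w.2 0 / a 0 + w.2 1 / a 1 + w.2 2 / a 2 + w.2 3 / a 3)
    (hQ1 : ∀ w ∈ W, 2 * (w.2 1 / a 1) = w.2 0 / a 0 + w.2 1 / a 1 + w.2 2 / a 2 + w.2 3 / a 3)
    (hQs : ∀ w ∈ W, w.2 0 / a 0 + w.2 1 / a 1 + w.2 2 / a 2 + w.2 3 / a 3 = 0) :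
    ((a 2 • Pi.single 2 1 + a 3 • Pi.single 3 1, 0) : (Fin 4 → K) × (Fin 4 → K)) ∈ W ∧
    ((a 0 • Pi.single 0 1 - a 1 • Pi.single 1 1, 0) : (Fin 4 → K) × (Fin 4 → K)) ∈ W ∧
    ((0, a 2 • Pi.single 2 1 - a 3 • Pi.single 3 1) : (Fin 4 → K) × (Fin 4 → K)) ∈ W := by
  set g₁ : (Fin 4 → K) × (Fin 4 → K) := (a 2 • Pi.single 2 1 + a 3 • Pi.single 3 1, 0) with hg₁
  set g₂ : (Fin 4 → K) × (Fin 4 → K) := (a 0 • Pi.single 0 1 - a 1 • Pi.single 1 1, 0) with hg₂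
  set g₃ : (Fin 4 → K) × (Fin 4 → K) := (0, a 2 • Pi.single 2 1 - a 3 • Pi.single 3 1) with hg₃
  set Λ : Submodule K ((Fin 4 → K) × (Fin 4 → K)) := Submodule.span K (Set.range ![g₁, g₂, g₃])
    with hΛ
  have h0 := ha 0; have h1 := ha 1; have h2 := ha 2; have h3' := ha 3
  -- every `w ∈ W` is an explicit combination of the generators
  have hle : W ≤ Λ := by
    intro w hw
    have e2 := hP2 w hw; have e3 := hP3 w hw; have f0 := hQ0 w hw; have f1 := hQ1 w hw
    have fs := hQs w hw
    obtain ⟨s, hs⟩ : ∃ s : K, s = w.1 0 / a 0 + w.1 1 / a 1 + w.1 2 / a 2 + w.1 3 / a 3 :=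
      ⟨_, rfl⟩
    -- coordinates in the rescaled frame
    have y1 : w.1 1 / a 1 = -(w.1 0 / a 0) := by linear_combination -hs - e2 / 2 - e3 / 2 + hs
    have y2 : w.1 2 / a 2 = s / 2 := by linear_combination e2 / 2 - hs / 2
    have y3 : w.1 3 / a 3 = s / 2 := by linear_combination e3 / 2 - hs / 2
    have z0 : w.2 0 / a 0 = 0 := by linear_combination f0 / 2 + fs / 2
    have z1 : w.2 1 / a 1 = 0 := by linear_combination f1 / 2 + fs / 2
    have z3 : w.2 3 / a 3 = -(w.2 2 / a 2) := by linear_combination fs - f0 / 2 - f1 / 2 - fs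
    have c10 : w.1 0 = (w.1 0 / a 0) * a 0 := by field_simp
    have c11 : w.1 1 = -(w.1 0 / a 0) * a 1 := by rw [← y1]; field_simp
    have c12 : w.1 2 = (s / 2) * a 2 := by rw [← y2]; field_simp
    have c13 : w.1 3 = (s / 2) * a 3 := by rw [← y3]; field_simp
    have c20 : w.2 0 = 0 := by
      have h := z0; rwa [div_eq_zero_iff, or_iff_left h0] at h
    have c21 : w.2 1 = 0 := by
      have h := z1; rwa [div_eq_zero_iff, or_iff_left h1] at h
    have c22 : w.2 2 = (w.2 2 / a 2) * a 2 := by field_simp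
    have c23 : w.2 3 = -(w.2 2 / a 2) * a 3 := by rw [← z3]; field_simp
    have hw_eq : w = (s / 2) • g₁ + (w.1 0 / a 0) • g₂ + (w.2 2 / a 2) • g₃ := by
      refine Prod.ext (funext fun i => ?_) (funext fun i => ?_) <;> fin_cases i <;>
        simp [hg₁, hg₂, hg₃] <;>
        first
          | linear_combination c10 | linear_combination c11 | linear_combination c12
          | linear_combination c13 | linear_combination c20 | linear_combination c21
          | linear_combination c22 | linear_combination c23
    rw [hw_eq]
    refine Submodule.add_mem _ (Submodule.add_mem _ (Submodule.smul_mem _ _ ?_)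
      (Submodule.smul_mem _ _ ?_)) (Submodule.smul_mem _ _ ?_)
    · exact Submodule.subset_span ⟨0, rfl⟩
    · exact Submodule.subset_span ⟨1, rfl⟩
    · exact Submodule.subset_span ⟨2, rfl⟩
  have hfin : finrank K Λ ≤ 3 := by
    have h := finrank_range_le_card (R := K) ![g₁, g₂, g₃]
    rwa [Fintype.card_fin] at h
  have heq : W = Λ := Submodule.eq_of_le_of_finrank_le hle (hfin.trans h3)
  refine ⟨?_, ?_, ?_⟩
  · rw [heq]; exact Submodule.subset_span ⟨0, rfl⟩
  · rw [heq]; exact Submodule.subset_span ⟨1, rfl⟩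
  · rw [heq]; exact Submodule.subset_span ⟨2, rfl⟩

/-- **Type II memberships** (p-side at `3, Σ`; q-side at `0,1,2`). [folklore] -/
theorem typeII_members [CharZero K] (a : Fin 4 → K) (ha : ∀ i, a i ≠ 0)
    (W : Submodule K ((Fin 4 → K) × (Fin 4 → K))) (h3 : 3 ≤ finrank K W)
    (hP3 : ∀ w ∈ W, 2 * (w.1 3 / a 3) = w.1 0 / a 0 + w.1 1 / a 1 + w.1 2 / a 2 + w.1 3 / a 3)
    (hPs : ∀ w ∈ W, w.1 0 / a 0 + w.1 1 / a 1 + w.1 2 / a 2 + w.1 3 / a 3 = 0)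
    (hQ0 : ∀ w ∈ W, 2 * (w.2 0 / a 0) = w.2 0 / a 0 + w.2 1 / a 1 + w.2 2 / a 2 + w.2 3 / a 3)
    (hQ1 : ∀ w ∈ W, 2 * (w.2 1 / a 1) = w.2 0 / a 0 + w.2 1 / a 1 + w.2 2 / a 2 + w.2 3 / a 3)
    (hQ2 : ∀ w ∈ W, 2 * (w.2 2 / a 2) = w.2 0 / a 0 + w.2 1 / a 1 + w.2 2 / a 2 + w.2 3 / a 3) :
    ((a 0 • Pi.single 0 1 - a 1 • Pi.single 1 1, 0) : (Fin 4 → K) × (Fin 4 → K)) ∈ W ∧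
    ((a 1 • Pi.single 1 1 - a 2 • Pi.single 2 1, 0) : (Fin 4 → K) × (Fin 4 → K)) ∈ W ∧
    ((0, a 0 • Pi.single 0 1 + a 1 • Pi.single 1 1 + a 2 • Pi.single 2 1 - a 3 • Pi.single 3 1) :
      (Fin 4 → K) × (Fin 4 → K)) ∈ W := by
  set g₁ : (Fin 4 → K) × (Fin 4 → K) := (a 0 • Pi.single 0 1 - a 1 • Pi.single 1 1, 0) with hg₁
  set g₂ : (Fin 4 → K) × (Fin 4 → K) := (a 1 • Pi.single 1 1 - a 2 • Pi.single 2 1, 0) with hg₂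
  set g₃ : (Fin 4 → K) × (Fin 4 → K) :=
    (0, a 0 • Pi.single 0 1 + a 1 • Pi.single 1 1 + a 2 • Pi.single 2 1 - a 3 • Pi.single 3 1)
    with hg₃
  set Λ : Submodule K ((Fin 4 → K) × (Fin 4 → K)) := Submodule.span K (Set.range ![g₁, g₂, g₃])
    with hΛ
  have h0 := ha 0; have h1 := ha 1; have h2 := ha 2; have h3' := ha 3
  have hle : W ≤ Λ := by
    intro w hw
    have e3 := hP3 w hw; have es := hPs w hw; have f0 := hQ0 w hw; have f1 := hQ1 w hw
    have f2 := hQ2 w hw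
    -- rescaled coordinates
    have y3 : w.1 3 / a 3 = 0 := by linear_combination e3 / 2 + es / 2
    have y2 : w.1 2 / a 2 = -(w.1 0 / a 0) - w.1 1 / a 1 := by linear_combination es - e3 / 2 - es / 2
    have z1 : w.2 1 / a 1 = w.2 0 / a 0 := by linear_combination f1 / 2 - f0 / 2
    have z2 : w.2 2 / a 2 = w.2 0 / a 0 := by linear_combination f2 / 2 - f0 / 2
    have z3 : w.2 3 / a 3 = -(w.2 0 / a 0) := by linear_combination -f1 / 2 - f2 / 2
    have c10 : w.1 0 = (w.1 0 / a 0) * a 0 := by field_simp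
    have c11 : w.1 1 = (w.1 1 / a 1) * a 1 := by field_simp
    have c12 : w.1 2 = (-(w.1 0 / a 0) - w.1 1 / a 1) * a 2 := by rw [← y2]; field_simp
    have c13 : w.1 3 = 0 := by
      have h := y3; rwa [div_eq_zero_iff, or_iff_left h3'] at h
    have c20 : w.2 0 = (w.2 0 / a 0) * a 0 := by field_simp
    have c21 : w.2 1 = (w.2 0 / a 0) * a 1 := by rw [← z1]; field_simp
    have c22 : w.2 2 = (w.2 0 / a 0) * a 2 := by rw [← z2]; field_simp
    have c23 : w.2 3 = -(w.2 0 / a 0) * a 3 := by rw [← z3]; field_simp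
    have hw_eq : w = (w.1 0 / a 0) • g₁ + (w.1 0 / a 0 + w.1 1 / a 1) • g₂ + (w.2 0 / a 0) • g₃ := by
      refine Prod.ext (funext fun i => ?_) (funext fun i => ?_) <;> fin_cases i <;>
        simp [hg₁, hg₂, hg₃] <;>
        first
          | linear_combination c10 | linear_combination c11 | linear_combination c12
          | linear_combination c13 | linear_combination c20 | linear_combination c21
          | linear_combination c22 | linear_combination c23
    rw [hw_eq]
    refine Submodule.add_mem _ (Submodule.add_mem _ (Submodule.smul_mem _ _ ?_)
      (Submodule.smul_mem _ _ ?_)) (Submodule.smul_mem _ _ ?_)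
    · exact Submodule.subset_span ⟨0, rfl⟩
    · exact Submodule.subset_span ⟨1, rfl⟩
    · exact Submodule.subset_span ⟨2, rfl⟩
  have hfin : finrank K Λ ≤ 3 := by
    have h := finrank_range_le_card (R := K) ![g₁, g₂, g₃]
    rwa [Fintype.card_fin] at h
  have heq : W = Λ := Submodule.eq_of_le_of_finrank_le hle (hfin.trans h3)
  refine ⟨?_, ?_, ?_⟩
  · rw [heq]; exact Submodule.subset_span ⟨0, rfl⟩
  · rw [heq]; exact Submodule.subset_span ⟨1, rfl⟩
  · rw [heq]; exact Submodule.subset_span ⟨2, rfl⟩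

end Summit.ValiantsHypothesis.ValiantsHypothesis.Theorems.SymPencilPerFourInnerRankSlotTypes

end
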